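import Mathlib.Analysis.Complex.Isometry
import Mathlib.MeasureTheory.Measure.Haar.InnerProductSpace
import Summits.CriticalPhenomena.SAWScalingLimit.Theorems.SAWDefectDecoherenceBoundaryClosureRGateTraceGreen
import Literature.Analysis.Complex.DbarAlongHolomorphic
import HarnessLib

/-!
# Green's formula on shifted half-planes in a zigzag direction
(crux `BoundaryClosureR`, stmt-CriticalPhenomena-14004, line `polygon-parity-squeeze`, sub-goal of the
registered stub `polygonLocalIdentity`, step (c); registered helper `green_levelLine`)

For the signed level `ℓ(w) = Re((w - z)·conj n)` of the line through `z` with unit normal `n`: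

* `∂̄ ℓ = n/2` and `∂̄(ℓχ) = (n/2)χ + ℓ ∂̄χ` (`dbarAlong_one_level`, `dbarAlong_one_levelMul`);
* the frame `A ζ = z + cζ`, `c = -i n`, carries `{Im ζ > t}` onto `{ℓ > t}`, preserves Lebesgue measure,
  and `∂̄(ψ ∘ A) = conj c · (∂̄ψ) ∘ A`;
* **Green's formula on `{ℓ > t}`** (`green_levelLine`): for `g` holomorphic on `{ℓ > t} ∩ B(z, s)` and
  continuous on `{ℓ ≥ t} ∩ B(z, s)` and `ψ ∈ C¹_c` supported in `B(z, s)`,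
  `∫_{ℓ > t} ∂̄ψ · g dA = -(n/2) ∫ ψ(A(x + it)) g(A(x + it)) dx`,
  transported from the horizontal case `GateTrace.gateTrace_green_halfPlane`.

References: folklore (Green's formula).  No definition is introduced.
-/

noncomputable section

open scoped Topology ComplexConjugate ContDiff
open Filter Set Metric MeasureTheory Complex
open Literature.Analysis.Complex (dbarAlong dbarAlong_one dbarAlong_eq_zero_of_notMem_tsupport
  continuous_dbarAlong_one tsupport_dbarAlong_one_subset dbarAlong_smul_left dbarAlong_one_comp_lineMap
  dbarAlong_smul hasCompactSupport_dbarAlong_one)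
open Summit.CriticalPhenomena.SAWScalingLimit.Theorems.PolygonParitySqueeze.GateTrace (gateTrace_green_halfPlane)

namespace Summit.CriticalPhenomena.SAWScalingLimit.Theorems.PolygonParitySqueeze.PolygonLocal

/-! ### 1. The level function and its `∂̄` -/

/-- The complexified level `w ↦ (Re((w - z)·conj n) : ℂ)` has real derivative `v ↦ Re(v·conj n)`.
[folklore] -/
theorem hasFDerivAt_level (z n w : ℂ) :
    HasFDerivAt (fun w : ℂ => ((((w - z) * conj n).re : ℝ) : ℂ))
      (Complex.ofRealCLM.comp (Complex.reCLM.comp (conj n • ContinuousLinearMap.id ℝ ℂ))) w := by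
  have h1 : HasFDerivAt (fun w : ℂ => (w - z) * conj n) (conj n • ContinuousLinearMap.id ℝ ℂ) w :=
    ((hasFDerivAt_id (𝕜 := ℝ) w).sub_const z).mul_const (conj n)
  exact Complex.ofRealCLM.hasFDerivAt.comp w (Complex.reCLM.hasFDerivAt.comp w h1)

/-- The complexified level is smooth. [folklore] -/
theorem contDiff_level (z n : ℂ) : ContDiff ℝ ∞ fun w : ℂ => ((((w - z) * conj n).re : ℝ) : ℂ) :=
  Complex.ofRealCLM.contDiff.comp (Complex.reCLM.contDiff.comp
    ((contDiff_id.sub contDiff_const).mul contDiff_const))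

/-- `∂̄ ℓ = n/2` for the complexified level `ℓ(w) = Re((w - z)·conj n)`. [folklore] -/
theorem dbarAlong_one_level (z n w : ℂ) :
    dbarAlong 1 (fun w : ℂ => ((((w - z) * conj n).re : ℝ) : ℂ)) w = n / 2 := by
  rw [dbarAlong_one, (hasFDerivAt_level z n w).fderiv]
  apply Complex.ext <;> simp <;> ring

/-- **`∂̄(ℓχ) = (n/2)χ + ℓ ∂̄χ`** at every point of real differentiability of `χ`. [folklore] -/
theorem dbarAlong_one_levelMul {χ : ℂ → ℂ} (z n : ℂ) {w : ℂ} (hχ : DifferentiableAt ℝ χ w) :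
    dbarAlong 1 (fun w : ℂ => ((((w - z) * conj n).re : ℝ) : ℂ) * χ w) w =
      n / 2 * χ w + ((((w - z) * conj n).re : ℝ) : ℂ) * dbarAlong 1 χ w := by
  have h := dbarAlong_smul (χ := fun w : ℂ => ((((w - z) * conj n).re : ℝ) : ℂ)) (f := χ) (x := w)
    (hasFDerivAt_level z n w).differentiableAt hχ 1
  simp only [smul_eq_mul] at h
  rw [h, dbarAlong_one_level]

/-! ### 2. The frame `w = z + c ζ`, `c = -i n` -/

/-- In the frame `w = z + c ζ` with `c = -i n`, `‖n‖ = 1`, the level is the imaginary part: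
`Re((z + cζ - z)·conj n) = Im ζ`. [folklore] -/
theorem level_frame {n : ℂ} (hn : ‖n‖ = 1) (z ζ : ℂ) :
    ((z + -I * n * ζ - z) * conj n).re = ζ.im := by
  have h1 : n * conj n = 1 := by
    rw [Complex.mul_conj, Complex.normSq_eq_norm_sq, hn]; norm_num
  have : (z + -I * n * ζ - z) * conj n = -I * ζ * (n * conj n) := by ring
  rw [this, h1, mul_one]
  simp

/-- The frame map `ζ ↦ z + c ζ` (`‖c‖ = 1`) preserves Lebesgue measure. [folklore] -/
theorem measurePreserving_frame (z c : ℂ) (hc : ‖c‖ = 1) :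
    MeasurePreserving (fun ζ : ℂ => z + c * ζ) volume volume := by
  set a : Circle := ⟨c, by simpa [Submonoid.unitSphere] using hc⟩ with ha
  have h1 : MeasurePreserving (rotation a : ℂ → ℂ) volume volume :=
    (rotation a).measurePreserving
  have h2 : (fun ζ : ℂ => z + c * ζ) = (fun w : ℂ => z + w) ∘ (rotation a : ℂ → ℂ) := by
    funext ζ; simp [rotation_apply, ha]
  rw [h2]
  exact (measurePreserving_add_left volume z).comp h1

/-- The frame map is a measurable embedding (it is a homeomorphism). [folklore] -/
theorem measurableEmbedding_frame (z c : ℂ) (hc : ‖c‖ = 1) :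
    MeasurableEmbedding (fun ζ : ℂ => z + c * ζ) := by
  have hc0 : c ≠ 0 := fun h => by rw [h, norm_zero] at hc; exact zero_ne_one hc
  have h : (fun ζ : ℂ => z + c * ζ) = ((Homeomorph.mulLeft₀ c hc0).trans (Homeomorph.addLeft z) : ℂ → ℂ) := by
    funext ζ; simp
  rw [h]
  exact (Homeomorph.measurableEmbedding _)

/-- The frame map is an isometry onto: `dist (z + cζ) z = ‖ζ‖`. [folklore] -/
theorem frame_mem_ball_iff {c : ℂ} (hc : ‖c‖ = 1) (z ζ : ℂ) (r : ℝ) :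
    z + c * ζ ∈ ball z r ↔ ζ ∈ ball (0 : ℂ) r := by
  rw [mem_ball, mem_ball, dist_eq_norm, dist_eq_norm, add_sub_cancel_left, sub_zero, norm_mul, hc,
    one_mul]

/-- `∂̄` in the frame: `∂̄(ψ ∘ A)(ζ) = conj c · (∂̄ψ)(A ζ)` for `A ζ = z + c ζ`. [folklore] -/
theorem dbarAlong_one_comp_frame {ψ : ℂ → ℂ} (z c : ℂ) {ζ : ℂ} (hψ : DifferentiableAt ℝ ψ (z + c * ζ)) :
    dbarAlong 1 (fun t : ℂ => ψ (z + c * t)) ζ = conj c * dbarAlong 1 ψ (z + c * ζ) := by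
  have h := dbarAlong_one_comp_lineMap (u := ψ) z c (t := ζ) (by simpa [smul_eq_mul, mul_comm] using hψ)
  have e1 : (fun s : ℂ => ψ (z + s • c)) = fun t : ℂ => ψ (z + c * t) := by
    funext s; simp [smul_eq_mul, mul_comm]
  rw [e1] at h
  rw [h, show z + ζ • c = z + c * ζ by simp [smul_eq_mul, mul_comm]]
  have h2 := dbarAlong_smul_left c (1 : ℂ) ψ (z + c * ζ)
  rw [smul_eq_mul, mul_one, smul_eq_mul] at h2
  exact h2

/-! ### 3. Green's formula on a shifted half-plane in the direction `n` -/

/-- **Green's formula on `{ℓ > t}`.**  For `g` holomorphic on `{ℓ > t} ∩ B(z, s)` and continuous on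
`{ℓ ≥ t} ∩ B(z, s)`, and `ψ ∈ C¹_c` supported in `B(z, s)`:
`∫_{ℓ > t} ∂̄ψ · g dA = -(n/2) ∫ ψ(A(x + it)) g(A(x + it)) dx`, `A ζ = z - i n ζ`. [folklore] -/
theorem setIntegral_dbarAlong_mul_eq_lineIntegral {g ψ : ℂ → ℂ} {z n : ℂ} (hn : ‖n‖ = 1) {t s : ℝ}
    (hg : DifferentiableOn ℂ g ({w : ℂ | t < ((w - z) * conj n).re} ∩ ball z s))
    (hgc : ContinuousOn g ({w : ℂ | t ≤ ((w - z) * conj n).re} ∩ ball z s))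
    (hψ : ContDiff ℝ 1 ψ) (hψc : HasCompactSupport ψ) (hψs : tsupport ψ ⊆ ball z s) :
    ∫ w in {w : ℂ | t < ((w - z) * conj n).re}, dbarAlong 1 ψ w * g w =
      -(n / 2) * ∫ x : ℝ, ψ (z + -I * n * ((x : ℂ) + (t : ℂ) * I)) * g (z + -I * n * ((x : ℂ) + (t : ℂ) * I)) := by
  set c : ℂ := -I * n with hc
  have hcn : ‖c‖ = 1 := by rw [hc, norm_mul, norm_neg, Complex.norm_I, one_mul, hn]
  have hcc : c * conj c = 1 := by
    rw [Complex.mul_conj, Complex.normSq_eq_norm_sq, hcn]; norm_num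
  set A : ℂ → ℂ := fun ζ => z + c * ζ with hA
  have hAlev : ∀ ζ, ((A ζ - z) * conj n).re = ζ.im := fun ζ => by
    simp only [hA, hc]; exact level_frame hn z ζ
  have hmp := measurePreserving_frame z c hcn
  have hme := measurableEmbedding_frame z c hcn
  ---------------------------------------------------------------- change of variables
  have hpre : A ⁻¹' {w : ℂ | t < ((w - z) * conj n).re} = {ζ : ℂ | t < ζ.im} := by
    ext ζ; simp only [mem_preimage, mem_setOf_eq, hAlev]
  have h1 : ∫ w in {w : ℂ | t < ((w - z) * conj n).re}, dbarAlong 1 ψ w * g w =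
      ∫ ζ in {ζ : ℂ | t < ζ.im}, dbarAlong 1 ψ (A ζ) * g (A ζ) := by
    rw [← hmp.setIntegral_preimage_emb hme (fun w => dbarAlong 1 ψ w * g w), hpre]
  ---------------------------------------------------------------- `∂̄` in the frame
  have hdiff : ∀ ζ, DifferentiableAt ℝ ψ (A ζ) := fun ζ => hψ.differentiable one_ne_zero _
  have h2 : ∀ ζ, dbarAlong 1 ψ (A ζ) = c * dbarAlong 1 (fun t : ℂ => ψ (A t)) ζ := by
    intro ζ
    rw [dbarAlong_one_comp_frame z c (hdiff ζ), ← mul_assoc, hcc, one_mul]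
  ---------------------------------------------------------------- Green in the frame
  have hAc : Continuous A := by simp only [hA]; fun_prop
  have hAd : Differentiable ℂ A := by simp only [hA]; fun_prop
  set V : Set ℂ := ball (0 : ℂ) s with hV
  have hAV : ∀ ζ, A ζ ∈ ball z s ↔ ζ ∈ V := fun ζ => frame_mem_ball_iff hcn z ζ s
  have hu : DifferentiableOn ℂ (fun ζ => g (A ζ)) ({ζ : ℂ | t < ζ.im} ∩ V) := by
    refine hg.comp hAd.differentiableOn fun ζ hζ => ⟨?_, (hAV ζ).2 hζ.2⟩
    show t < ((A ζ - z) * conj n).re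
    rw [hAlev]; exact hζ.1
  have huc : ContinuousOn (fun ζ => g (A ζ)) ({ζ : ℂ | t ≤ ζ.im} ∩ V) := by
    refine hgc.comp hAc.continuousOn fun ζ hζ => ⟨?_, (hAV ζ).2 hζ.2⟩
    show t ≤ ((A ζ - z) * conj n).re
    rw [hAlev]; exact hζ.1
  have hφ : ContDiff ℝ 1 fun ζ => ψ (A ζ) := hψ.comp (by simp only [hA]; fun_prop)
  have hφc : HasCompactSupport fun ζ => ψ (A ζ) := by
    have hc0 : c ≠ 0 := fun h => by rw [h, norm_zero] at hcn; exact zero_ne_one hcn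
    have h := hψc.comp_homeomorph ((Homeomorph.mulLeft₀ c hc0).trans (Homeomorph.addLeft z))
    have e : (ψ ∘ ((Homeomorph.mulLeft₀ c hc0).trans (Homeomorph.addLeft z) : ℂ → ℂ)) = fun ζ => ψ (A ζ) := by
      funext ζ; simp [hA]
    rwa [e] at h
  have hφV : tsupport (fun ζ => ψ (A ζ)) ⊆ V := by
    refine (tsupport_comp_subset_preimage ψ hAc).trans fun ζ hζ => ?_
    exact (hAV ζ).1 (hψs hζ)
  have key := gateTrace_green_halfPlane (fun ζ => g (A ζ)) (fun ζ => ψ (A ζ)) t V isOpen_ball hu huc hφ hφc hφV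
  ---------------------------------------------------------------- assemble
  have h3 : ∫ ζ in {ζ : ℂ | t < ζ.im}, dbarAlong 1 ψ (A ζ) * g (A ζ) =
      c * ∫ ζ in {ζ : ℂ | t < ζ.im}, dbarAlong 1 (fun t : ℂ => ψ (A t)) ζ * g (A ζ) := by
    rw [← integral_const_mul]
    refine integral_congr_ae (Eventually.of_forall fun ζ => ?_)
    simp only [h2]; ring
  rw [h1, h3, key, ← mul_assoc]
  congr 1
  rw [hc]; ring_nf; rw [Complex.I_sq]; ring

/-- **Registered helper `green_levelLine`** (sub-goal of `polygonLocalIdentity`): Green's formula on the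
shifted half-plane `{ℓ > t}` in the direction `n`, registry form of
`setIntegral_dbarAlong_mul_eq_lineIntegral`. [folklore] -/
theorem green_levelLine : ∀ (g ψ : ℂ → ℂ) (z n : ℂ) (t s : ℝ), ‖n‖ = 1 → DifferentiableOn ℂ g ({w : ℂ | t < ((w - z) * (starRingEnd ℂ) n).re} ∩ Metric.ball z s) → ContinuousOn g ({w : ℂ | t ≤ ((w - z) * (starRingEnd ℂ) n).re} ∩ Metric.ball z s) → ContDiff ℝ 1 ψ → HasCompactSupport ψ → tsupport ψ ⊆ Metric.ball z s → ∫ w in {w : ℂ | t < ((w - z) * (starRingEnd ℂ) n).re}, Literature.Analysis.Complex.dbarAlong 1 ψ w * g w = -(n / 2) * ∫ x : ℝ, ψ (z + -Complex.I * n * ((x : ℂ) + (t : ℂ) * Complex.I)) * g (z + -Complex.I * n * ((x : ℂ) + (t : ℂ) * Complex.I)) :=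
  fun _ _ _ _ _ _ hn hg hgc hψ hψc hψs => setIntegral_dbarAlong_mul_eq_lineIntegral hn hg hgc hψ hψc hψs

end Summit.CriticalPhenomena.SAWScalingLimit.Theorems.PolygonParitySqueeze.PolygonLocal

end
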